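import Mathlib.GroupTheory.FreeAbelianGroup
import Mathlib.GroupTheory.QuotientGroup.Basic
import Mathlib.Algebra.Group.Units.Hom
import Mathlib.Algebra.Ring.Hom.Defs
import Mathlib.Algebra.BigOperators.Group.List.Basic
import Mathlib.Data.Fin.VecNotation
import Mathlib.Tactic.FinCases
import Mathlib.Tactic.Abel
import HarnessLib

/-!
# Kato's cohomology groups `H^{n+1}_p(K)` in characteristic `p`: the symbolic presentation

For a field `K` of characteristic `p > 0` and `n ≥ 0`, Kato's group
`H^{n+1}_p(K) := H¹(K, Ω^n_{K^sep, log}) = coker(℘ = F − 1 : Ω^n_K → Ω^n_K / dΩ^{n−1}_K)`,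
`℘(a · db₁/b₁ ∧ ⋯ ∧ dbₙ/bₙ) = (a^p − a) · db₁/b₁ ∧ ⋯ ∧ dbₙ/bₙ`
([cite: Izhboldin1996, Def. 1.4]; [cite: GilleSzamuely2017, Rem. 6.1.11 and Thm. 9.2.4];
the groups and the notation `H^q_p` are Kato's [cite: Kato1982, §1]), has the classical
PRESENTATION BY SYMBOLS: it is the abelian group generated by the symbols
`[a, b₁, …, bₙ}` (`a ∈ K`, `bᵢ ∈ Kˣ`; the class of `a · db₁/b₁ ∧ ⋯ ∧ dbₙ/bₙ`) subject to

1. additivity in `a`;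
2. multiplicativity in each `bᵢ`;
3. `[a, b₁, …, bₙ} = 0` if `bᵢ = bⱼ` for some `i ≠ j`;
4. `[a, b₁, …, bₙ} = 0` if `a = bᵢ` for some `i`;
5. `[a^p − a, b₁, …, bₙ} = 0` (Artin–Schreier).

Indeed `Ω^n_K = (K ⊗ (Kˣ)^{⊗ n}) / ⟨(1)–(3), (4′)⟩` by the lemma of Bloch–Kato
[cite: BlochKato1986, Lemma (4.2), p. 122] (`δ(x ⊗ y₁ ⊗ ⋯ ⊗ yₙ) = x · dy₁/y₁ ∧ ⋯ ∧ dyₙ/yₙ` is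
surjective for a ring additively generated by its units, with kernel generated by (4.2.1) = (3) and
(4.2.2) = differences of `Σ xᵢ ⊗ xᵢ ⊗ y` with equal `Σ xᵢ`); dividing further by
`dΩ^{n−1}_K = ⟨d(x · dy₂/y₂ ∧ ⋯) = x · dx/x ∧ dy₂/y₂ ∧ ⋯⟩` is relation (4) (which absorbs (4.2.2)),
and dividing by `(F − 1)Ω^n_K` is relation (5).  This is the form in which the groups are USED
(symbols, integrality of symbols, residues), e.g. route WildPurity of the summit
ResolutionOfSingularities inlines exactly this presentation for `n = 2` (`H³_p`).

## Contents (all definitions are real, all lemmas proved; no named fact is introduced)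

* `katoRelations p K n` — the set of defining relations (1)–(5) inside
  `FreeAbelianGroup (K × (Fin n → Kˣ))`;
* `KatoCohomologySymbolic p K n` — **Kato's `H^{n+1}_p(K)`**, the quotient of the free abelian
  group on `K × (Fin n → Kˣ)` by the subgroup generated by `katoRelations p K n`
  (so `H¹_p = KatoCohomologySymbolic p K 0 = K/℘K`, `H²_p = … 1` (`= Br(K)[p]`),
  **`H³_p(K) = KatoCohomologySymbolic p K 2`**).  INDEXING: the natural-number argument is the
  number `n` of `dlog` slots, i.e. the degree is `n + 1` (the `H^{n+1}_p` convention of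
  Izhboldin and Gille–Szamuely), so that no natural subtraction appears in types;
* `symbol p a b` — the class `[a, b 0, …, b (n-1)}`; the relations as lemmas (`symbol_add`,
  `symbol_update_mul`, `symbol_eq_zero_of_apply_eq`, `symbol_apply_self`,
  `symbol_artinSchreier`, …), the `n = 2` forms with `![b, c]` (`symbol_pair_*`);
* `KatoCohomologySymbolic.induction_on`, `closure_range_symbol` (generated by symbols),
  the universal property `lift` / `lift_symbol` / `hom_ext` for maps out of `H^{n+1}_p(K)`
  (`IsKatoCompatible p f` = "`f` respects (1)–(5)");
* functoriality in `K`: `map p f : H^{n+1}_p(K) →+ H^{n+1}_p(L)` for a ring map `f : K →+* L`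
  (`map_symbol`, `map_id`, `map_comp`);
* INTEGRAL SYMBOLS: for `T ⊆ K`, `integralSymbols p n T ⊆ H^{n+1}_p(K)` is the subgroup generated
  by the symbols `[a, b₁, …, bₙ}` with `a ∈ T` and `bᵢ, bᵢ⁻¹ ∈ T` ("`T`-integral", or unramified,
  classes: for a discrete valuation ring `T = O_K` this is Kato's / Izhboldin's
  `U₀ H^{n+1}_p(K) = H^{n+1}_{p,ur}` [cite: Izhboldin1996, §2, (2.3) and Thm. 2.5]);
  `symbol_mem_integralSymbols`, `integralSymbols_mono`, `integralSymbols_univ`,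
  `map_integralSymbols_le` (functoriality).

## Design / scope

* The definitions make sense for any commutative ring `K` and any `p : ℕ`; they carry their
  intended meaning for `K` a field with `CharP K p`, `p` prime (no instance is assumed, so that
  users may quantify freely).
* Deliberately NOT here: the comparison isomorphisms
  `KatoCohomologySymbolic p K n ≃ Ω^n_K/(dΩ^{n−1}_K + (F − 1)Ω^n_K) ≃ H¹(K, Ω^n_log)` and, for
  `n = 1`, `≃ Br(K)[p]` [cite: GilleSzamuely2017, Thm. 9.2.4] — Mathlib has neither the de Rham
  complex of absolute Kähler differentials in degrees `≥ 2` nor the (inverse) Cartier operator, and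
  no unproved named fact is introduced here (D-0026); the `p^m`-torsion groups `H^{n+1}_{p^m}`
  (Witt-vector symbols) are not treated either.

## References

* K. Kato, *Galois cohomology of complete discrete valuation fields*, Algebraic K-theory
  (Oberwolfach 1980) II, LNM 967 (1982), 215–238, §1 — origin of `H^q_p` and of the symbolic
  calculus (primary source; paywalled, acquisition request acq-06473, locator as given by the
  requesting route). [Kato1982]
* S. Bloch, K. Kato, *p-adic étale cohomology*, Publ. Math. IHÉS 63 (1986), Lemma (4.2), p. 122
  — read (held). [BlochKato1986]
* O. T. Izhboldin, *On the cohomology groups of the field of rational functions*, Mathematics in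
  St. Petersburg, AMS Transl. (2) 174 (1996), 21–44, Def. 1.4, §2 — read. [Izhboldin1996]
* P. Gille, T. Szamuely, *Central simple algebras and Galois cohomology*, 2nd ed., CUP 2017,
  Rem. 6.1.11, §9.2 (Thm. 9.2.4) — read. [GilleSzamuely2017]
-/

open Function

namespace Literature.NumberTheory.GaloisCohomology

universe u v w

section Defs

variable (p : ℕ) (K : Type u) [CommRing K] (n : ℕ)

/-- The defining relations of Kato's group `H^{n+1}_p(K)` in its symbolic presentation, as a
subset of the free abelian group on the generators `(a, b) : K × (Fin n → Kˣ)` (the generator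
`(a, b)` stands for the symbol `[a, b 0, …, b (n-1)}` = "`a · dlog (b 0) ∧ ⋯ ∧ dlog (b (n-1))`"):
(1) additivity in `a`; (2) multiplicativity in each slot `bᵢ`; (3) the symbol vanishes when two
distinct slots carry the same unit; (4) the symbol vanishes when `a = bᵢ` for some slot `i`
(`x · dx/x ∧ ⋯ = d(⋯)` is exact); (5) `[a ^ p - a, b} = 0` (Artin–Schreier, `(F - 1)`).
[cite: BlochKato1986, Lemma (4.2), p. 122] for (1)–(4) presenting `Ω^n_K / dΩ^{n-1}_K`;
[cite: Izhboldin1996, Def. 1.4] for (5). -/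
def katoRelations : Set (FreeAbelianGroup (K × (Fin n → Kˣ))) :=
  {x | (∃ (a a' : K) (b : Fin n → Kˣ), x = .of (a + a', b) - .of (a, b) - .of (a', b)) ∨
    (∃ (a : K) (b : Fin n → Kˣ) (i : Fin n) (c c' : Kˣ),
      x = .of (a, update b i (c * c')) - .of (a, update b i c) - .of (a, update b i c')) ∨
    (∃ (a : K) (b : Fin n → Kˣ) (i j : Fin n), i ≠ j ∧ b i = b j ∧ x = .of (a, b)) ∨
    (∃ (b : Fin n → Kˣ) (i : Fin n), x = .of ((b i : K), b)) ∨
    (∃ (a : K) (b : Fin n → Kˣ), x = .of (a ^ p - a, b))}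

/-- **Kato's cohomology group `H^{n+1}_p(K)` of a ring `K` (of characteristic `p`), in its
symbolic presentation**: the free abelian group on the symbols `[a, b₁, …, bₙ}` (`a ∈ K`,
`bᵢ ∈ Kˣ`) modulo the subgroup generated by `katoRelations p K n` (additive in `a`,
multiplicative in each `bᵢ`, zero if `bᵢ = bⱼ` (`i ≠ j`) or `a = bᵢ`, and `[a^p - a, b} = 0`).
For a field `K` of characteristic `p` this is `K ⊗ (Kˣ)^{⊗ n} / J ≅ Ω^n_K/(dΩ^{n-1}_K + (F-1)Ω^n_K)
= H¹(K, Ω^n_log) = H^{n+1}_p(K)`; in particular `n = 0, 1, 2` give `H¹_p(K) = K/℘K`,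
`H²_p(K) = Br(K)[p]`, and `H³_p(K)`.  NOTE THE INDEX: the last argument is the number `n` of
unit slots, the cohomological degree is `n + 1`.
[cite: Kato1982, §1] (origin); [cite: Izhboldin1996, Def. 1.4];
[cite: BlochKato1986, Lemma (4.2), p. 122]; [cite: GilleSzamuely2017, Rem. 6.1.11]. -/
abbrev KatoCohomologySymbolic : Type u :=
  FreeAbelianGroup (K × (Fin n → Kˣ)) ⧸ AddSubgroup.closure (katoRelations p K n)

end Defs

namespace KatoCohomologySymbolic

variable (p : ℕ) {K : Type u} [CommRing K] {n : ℕ}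

/-- The symbol `[a, b 0, …, b (n-1)} ∈ H^{n+1}_p(K)`: the class of the generator `(a, b)`
(informally `a · dlog (b 0) ∧ ⋯ ∧ dlog (b (n-1))`). [cite: Kato1982, §1] -/
def symbol (a : K) (b : Fin n → Kˣ) : KatoCohomologySymbolic p K n :=
  ((FreeAbelianGroup.of (a, b) : FreeAbelianGroup (K × (Fin n → Kˣ))) :
    KatoCohomologySymbolic p K n)

/-- The class of the generator `(a, b)` is the symbol `[a, b}` (by definition). [folklore] -/
@[simp] theorem mk_of (a : K) (b : Fin n → Kˣ) :
    ((FreeAbelianGroup.of (a, b) : FreeAbelianGroup (K × (Fin n → Kˣ))) :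
      KatoCohomologySymbolic p K n) = symbol p a b := rfl

/-- A defining relation is zero in the quotient. [folklore] -/
theorem mk_eq_zero_of_mem {x : FreeAbelianGroup (K × (Fin n → Kˣ))}
    (hx : x ∈ katoRelations p K n) : (x : KatoCohomologySymbolic p K n) = 0 :=
  (QuotientAddGroup.eq_zero_iff x).2 (AddSubgroup.subset_closure hx)

/-- A relation of the shape `x - y - z` gives `x = y + z` in the quotient. [folklore] -/
private theorem mk_eq_add_of_mem {x y z : FreeAbelianGroup (K × (Fin n → Kˣ))}
    (h : x - y - z ∈ katoRelations p K n) :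
    (x : KatoCohomologySymbolic p K n) = y + z := by
  have h' := mk_eq_zero_of_mem p h
  rwa [QuotientAddGroup.mk_sub, QuotientAddGroup.mk_sub, sub_sub, sub_eq_zero] at h'

/-! ### The defining relations, as identities between symbols -/

/-- Relation (1): `[a + a', b} = [a, b} + [a', b}`. [cite: BlochKato1986, Lemma (4.2)] -/
theorem symbol_add (a a' : K) (b : Fin n → Kˣ) :
    symbol p (a + a') b = symbol p a b + symbol p a' b :=
  mk_eq_add_of_mem p (Or.inl ⟨a, a', b, rfl⟩)

/-- Relation (2): multiplicativity in the slot `i`,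
`[a, …, c * c', …} = [a, …, c, …} + [a, …, c', …}`. [cite: BlochKato1986, Lemma (4.2)] -/
theorem symbol_update_mul (a : K) (b : Fin n → Kˣ) (i : Fin n) (c c' : Kˣ) :
    symbol p a (update b i (c * c')) = symbol p a (update b i c) + symbol p a (update b i c') :=
  mk_eq_add_of_mem p (Or.inr <| Or.inl ⟨a, b, i, c, c', rfl⟩)

/-- Relation (3): `[a, b} = 0` if two distinct slots carry the same unit (`dlog b ∧ dlog b = 0`).
[cite: BlochKato1986, Lemma (4.2), (4.2.1)] -/
theorem symbol_eq_zero_of_apply_eq (a : K) (b : Fin n → Kˣ) {i j : Fin n} (hij : i ≠ j)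
    (h : b i = b j) : symbol p a b = 0 :=
  mk_eq_zero_of_mem p (Or.inr <| Or.inr <| Or.inl ⟨a, b, i, j, hij, h, rfl⟩)

/-- Relation (4): `[bᵢ, b} = 0` (`bᵢ · dlog bᵢ ∧ ⋯ = dbᵢ ∧ ⋯` is exact).
[cite: BlochKato1986, Lemma (4.2), (4.2.2)]; [cite: Izhboldin1996, Def. 1.4] -/
theorem symbol_apply_self (b : Fin n → Kˣ) (i : Fin n) : symbol p (b i : K) b = 0 :=
  mk_eq_zero_of_mem p (Or.inr <| Or.inr <| Or.inr <| Or.inl ⟨b, i, rfl⟩)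

/-- Relation (5), Artin–Schreier: `[a ^ p - a, b} = 0` (the image of `F - 1`).
[cite: Izhboldin1996, Def. 1.4] -/
theorem symbol_artinSchreier (a : K) (b : Fin n → Kˣ) : symbol p (a ^ p - a) b = 0 :=
  mk_eq_zero_of_mem p (Or.inr <| Or.inr <| Or.inr <| Or.inr ⟨a, b, rfl⟩)

/-- `a ↦ [a, b}` as a homomorphism of additive groups `K →+ H^{n+1}_p(K)`. [folklore] -/
def symbolHom (b : Fin n → Kˣ) : K →+ KatoCohomologySymbolic p K n :=
  AddMonoidHom.mk' (fun a => symbol p a b) fun a a' => symbol_add p a a' b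

/-- `symbolHom p b a = [a, b}`. [folklore] -/
@[simp] theorem symbolHom_apply (b : Fin n → Kˣ) (a : K) :
    symbolHom p b a = symbol p a b := rfl

/-- `[0, b} = 0`. [folklore] -/
@[simp] theorem symbol_zero (b : Fin n → Kˣ) : symbol p (0 : K) b = 0 :=
  (symbolHom p b).map_zero

/-- `[-a, b} = -[a, b}`. [folklore] -/
theorem symbol_neg (a : K) (b : Fin n → Kˣ) : symbol p (-a) b = -symbol p a b :=
  (symbolHom p b).map_neg a

/-- `[a - a', b} = [a, b} - [a', b}`. [folklore] -/
theorem symbol_sub (a a' : K) (b : Fin n → Kˣ) :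
    symbol p (a - a') b = symbol p a b - symbol p a' b :=
  (symbolHom p b).map_sub a a'

/-- `[m • a, b} = m • [a, b}` for `m : ℤ`. [folklore] -/
theorem symbol_zsmul (m : ℤ) (a : K) (b : Fin n → Kˣ) :
    symbol p (m • a) b = m • symbol p a b :=
  map_zsmul (symbolHom p b) m a

/-- Artin–Schreier in the form `[a ^ p, b} = [a, b}` (Frobenius acts trivially on `H^{n+1}_p`).
[cite: Izhboldin1996, Def. 1.4] -/
theorem symbol_pow_char (a : K) (b : Fin n → Kˣ) : symbol p (a ^ p) b = symbol p a b := by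
  rw [← sub_eq_zero, ← symbol_sub, symbol_artinSchreier]

/-- `[a, …, 1, …} = 0` (slot `i` equal to `1`). [folklore] -/
@[simp] theorem symbol_update_one (a : K) (b : Fin n → Kˣ) (i : Fin n) :
    symbol p a (update b i 1) = 0 := by
  have h := symbol_update_mul p a b i 1 1
  rw [mul_one] at h
  -- `h : s = s + s`
  have h' : symbol p a (update b i 1) + symbol p a (update b i 1) =
      symbol p a (update b i 1) + 0 := by rw [add_zero]; exact h.symm
  exact add_left_cancel h'

/-- `[a, …, c⁻¹, …} = -[a, …, c, …}`. [folklore] -/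
theorem symbol_update_inv (a : K) (b : Fin n → Kˣ) (i : Fin n) (c : Kˣ) :
    symbol p a (update b i c⁻¹) = -symbol p a (update b i c) := by
  rw [eq_neg_iff_add_eq_zero, add_comm, ← symbol_update_mul, mul_inv_cancel, symbol_update_one]

/-! ### Induction, generation by symbols, universal property -/

/-- Every element of `H^{n+1}_p(K)` is a `ℤ`-linear combination of symbols: induction principle.
[cite: BlochKato1986, Lemma (4.2)] (surjectivity of `δ`) -/
@[elab_as_elim]
protected theorem induction_on {P : KatoCohomologySymbolic p K n → Prop}
    (x : KatoCohomologySymbolic p K n) (zero : P 0)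
    (of : ∀ (a : K) (b : Fin n → Kˣ), P (symbol p a b))
    (add : ∀ x y, P x → P y → P (x + y)) : P x := by
  induction x using QuotientAddGroup.induction_on with
  | H z =>
    induction z using FreeAbelianGroup.induction_on with
    | zero => rwa [QuotientAddGroup.mk_zero]
    | of ab => exact of ab.1 ab.2
    | neg ab _ =>
      rw [QuotientAddGroup.mk_neg, mk_of, ← symbol_neg]
      exact of _ _
    | add x y hx hy =>
      rw [QuotientAddGroup.mk_add]
      exact add _ _ hx hy

/-- `H^{n+1}_p(K)` is generated by the symbols. [cite: BlochKato1986, Lemma (4.2)] -/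
theorem closure_range_symbol :
    AddSubgroup.closure (Set.range fun ab : K × (Fin n → Kˣ) => symbol p ab.1 ab.2) = ⊤ := by
  rw [eq_top_iff]
  rintro x -
  induction x using KatoCohomologySymbolic.induction_on p with
  | zero => exact AddSubgroup.zero_mem _
  | of a b => exact AddSubgroup.subset_closure ⟨(a, b), rfl⟩
  | add x y hx hy => exact AddSubgroup.add_mem _ hx hy

/-- Every class is a finite sum of symbols `Σ [aₖ, bₖ}` (signs are absorbed by additivity in `a`).
[cite: BlochKato1986, Lemma (4.2)] -/
theorem exists_list_sum_symbol_eq (x : KatoCohomologySymbolic p K n) :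
    ∃ l : List (K × (Fin n → Kˣ)), (l.map fun ab => symbol p ab.1 ab.2).sum = x := by
  induction x using KatoCohomologySymbolic.induction_on p with
  | zero => exact ⟨[], by simp⟩
  | of a b => exact ⟨[(a, b)], by simp⟩
  | add x y hx hy =>
    obtain ⟨l, rfl⟩ := hx
    obtain ⟨m, rfl⟩ := hy
    exact ⟨l ++ m, by simp⟩

variable {A : Type v} [AddCommGroup A]

/-- A map `f : K → (Fin n → Kˣ) → A` on symbols RESPECTS KATO'S RELATIONS (1)–(5)
(additive in `a`, multiplicative in each slot, alternating, `f bᵢ b = 0`, Artin–Schreier);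
such maps are exactly those that factor through `H^{n+1}_p(K)` (`lift`, `hom_ext`). [folklore] -/
structure IsKatoCompatible (f : K → (Fin n → Kˣ) → A) : Prop where
  /-- additivity in `a` -/
  add_left : ∀ (a a' : K) (b : Fin n → Kˣ), f (a + a') b = f a b + f a' b
  /-- multiplicativity in each slot -/
  update_mul : ∀ (a : K) (b : Fin n → Kˣ) (i : Fin n) (c c' : Kˣ),
    f a (update b i (c * c')) = f a (update b i c) + f a (update b i c')
  /-- vanishing when two distinct slots agree -/
  eq_zero_of_apply_eq : ∀ (a : K) (b : Fin n → Kˣ) (i j : Fin n), i ≠ j → b i = b j → f a b = 0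
  /-- vanishing when `a` equals a slot -/
  apply_self : ∀ (b : Fin n → Kˣ) (i : Fin n), f (b i : K) b = 0
  /-- Artin–Schreier relation -/
  artinSchreier : ∀ (a : K) (b : Fin n → Kˣ), f (a ^ p - a) b = 0

/-- The symbol map itself respects the relations. [folklore] -/
theorem isKatoCompatible_symbol : IsKatoCompatible p (n := n) (symbol p (K := K)) where
  add_left := symbol_add p
  update_mul := symbol_update_mul p
  eq_zero_of_apply_eq a b _ _ hij h := symbol_eq_zero_of_apply_eq p a b hij h
  apply_self := symbol_apply_self p
  artinSchreier := symbol_artinSchreier p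

/-- UNIVERSAL PROPERTY: a map on symbols respecting Kato's relations extends (uniquely, see
`hom_ext`) to an additive homomorphism out of `H^{n+1}_p(K)`. [folklore] -/
def lift (f : K → (Fin n → Kˣ) → A) (hf : IsKatoCompatible p f) :
    KatoCohomologySymbolic p K n →+ A :=
  QuotientAddGroup.lift _ (FreeAbelianGroup.lift fun ab : K × (Fin n → Kˣ) => f ab.1 ab.2) (by
    rw [AddSubgroup.closure_le]
    rintro x (⟨a, a', b, rfl⟩ | ⟨a, b, i, c, c', rfl⟩ | ⟨a, b, i, j, hij, hb, rfl⟩ |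
      ⟨b, i, rfl⟩ | ⟨a, b, rfl⟩)
    · simp only [SetLike.mem_coe, AddMonoidHom.mem_ker, map_sub,
        FreeAbelianGroup.lift_apply_of, hf.add_left]
      abel
    · simp only [SetLike.mem_coe, AddMonoidHom.mem_ker, map_sub,
        FreeAbelianGroup.lift_apply_of, hf.update_mul a b i c c']
      abel
    · simpa only [SetLike.mem_coe, AddMonoidHom.mem_ker, FreeAbelianGroup.lift_apply_of] using
        hf.eq_zero_of_apply_eq a b i j hij hb
    · simpa only [SetLike.mem_coe, AddMonoidHom.mem_ker, FreeAbelianGroup.lift_apply_of] using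
        hf.apply_self b i
    · simpa only [SetLike.mem_coe, AddMonoidHom.mem_ker, FreeAbelianGroup.lift_apply_of] using
        hf.artinSchreier a b)

/-- The lift takes the prescribed values on symbols. [folklore] -/
@[simp] theorem lift_symbol (f : K → (Fin n → Kˣ) → A) (hf : IsKatoCompatible p f) (a : K)
    (b : Fin n → Kˣ) : lift p f hf (symbol p a b) = f a b := by
  show QuotientAddGroup.lift _ _ _ (QuotientAddGroup.mk (FreeAbelianGroup.of (a, b))) = _
  rw [QuotientAddGroup.lift_mk, FreeAbelianGroup.lift_apply_of]

/-- Two homomorphisms out of `H^{n+1}_p(K)` that agree on symbols are equal. [folklore] -/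
theorem hom_ext {g h : KatoCohomologySymbolic p K n →+ A}
    (H : ∀ (a : K) (b : Fin n → Kˣ), g (symbol p a b) = h (symbol p a b)) : g = h :=
  QuotientAddGroup.addMonoidHom_ext _ (FreeAbelianGroup.lift_ext _ _ fun ab => H ab.1 ab.2)

/-! ### Functoriality in `K` -/

section Map

variable {L : Type w} [CommRing L] {M : Type*} [CommRing M]

/-- For a ring homomorphism `f`, `(a, b) ↦ [f a, f ∘ b}` respects the relations. [folklore] -/
theorem isKatoCompatible_symbol_map (f : K →+* L) :
    IsKatoCompatible p (n := n) fun (a : K) (b : Fin n → Kˣ) =>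
      symbol p (f a) (Units.map (f : K →* L) ∘ b) where
  add_left a a' b := by simp only [map_add, symbol_add]
  update_mul a b i c c' := by simp only [comp_update, map_mul, symbol_update_mul]
  eq_zero_of_apply_eq a b i j hij hb :=
    symbol_eq_zero_of_apply_eq p _ _ hij (by simp only [comp_apply, hb])
  apply_self b i := by
    simpa only [comp_apply, Units.coe_map, MonoidHom.coe_coe] using
      symbol_apply_self p (Units.map (f : K →* L) ∘ b) i
  artinSchreier a b := by simp only [map_sub, map_pow, symbol_artinSchreier]

/-- Functoriality of `H^{n+1}_p` in the ring: `[a, b} ↦ [f a, f ∘ b}` for `f : K →+* L`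
(restriction to an extension, reduction to a residue field on integral symbols, …).
[cite: Kato1982, §1] -/
def map (f : K →+* L) : KatoCohomologySymbolic p K n →+ KatoCohomologySymbolic p L n :=
  lift p _ (isKatoCompatible_symbol_map p f)

/-- `map p f [a, b} = [f a, f ∘ b}`. [folklore] -/
@[simp] theorem map_symbol (f : K →+* L) (a : K) (b : Fin n → Kˣ) :
    map p f (symbol p a b) = symbol p (f a) (Units.map (f : K →* L) ∘ b) :=
  lift_symbol p _ _ a b

/-- `map` of the identity is the identity. [folklore] -/
theorem map_id : map p (RingHom.id K) = AddMonoidHom.id (KatoCohomologySymbolic p K n) :=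
  hom_ext p fun a b => by
    rw [map_symbol, AddMonoidHom.id_apply]
    exact congrArg _ (funext fun i => Units.ext (by simp))

/-- `map` is compatible with composition. [folklore] -/
theorem map_comp (g : L →+* M) (f : K →+* L) :
    map p (n := n) (g.comp f) = (map p g).comp (map p f) :=
  hom_ext p fun a b => by
    rw [map_symbol, AddMonoidHom.comp_apply, map_symbol, map_symbol]
    exact congrArg _ (funext fun i => Units.ext (by simp))

end Map

/-! ### Integral (unramified) symbols with respect to a subring -/

section Integral

variable (n)

/-- INTEGRAL SYMBOLS: for a subset (typically a local subring, a valuation ring) `T ⊆ K`, the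
subgroup `Unr(T) ⊆ H^{n+1}_p(K)` generated by the `T`-integral symbols `[a, b₁, …, bₙ}`, i.e. those
with `a ∈ T` and `bᵢ, bᵢ⁻¹ ∈ T` for all `i`.  For the valuation ring `T` of a discrete valuation on
`K` this is the unramified part `U₀ H^{n+1}_p(K) = H^{n+1}_{p,ur}(K)`
[cite: Izhboldin1996, §2, (2.3) and Thm. 2.5]; for a regular local ring it is the image of
`H^{n+1}_p(T)` (Bloch–Kato).  This is the integrality notion of route WildPurity
(summit ResolutionOfSingularities). -/
def integralSymbols (T : Set K) : AddSubgroup (KatoCohomologySymbolic p K n) :=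
  AddSubgroup.closure {x | ∃ (a : K) (b : Fin n → Kˣ), a ∈ T ∧
    (∀ i, (b i : K) ∈ T ∧ (((b i)⁻¹ : Kˣ) : K) ∈ T) ∧ x = symbol p a b}

variable {n}

/-- A `T`-integral symbol lies in `integralSymbols p n T`. [folklore] -/
theorem symbol_mem_integralSymbols {T : Set K} {a : K} {b : Fin n → Kˣ} (ha : a ∈ T)
    (hb : ∀ i, (b i : K) ∈ T ∧ (((b i)⁻¹ : Kˣ) : K) ∈ T) :
    symbol p a b ∈ integralSymbols p n T :=
  AddSubgroup.subset_closure ⟨a, b, ha, hb, rfl⟩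

/-- `integralSymbols` is monotone in `T`. [folklore] -/
theorem integralSymbols_mono {T T' : Set K} (h : T ⊆ T') :
    integralSymbols p n T ≤ integralSymbols p n T' :=
  AddSubgroup.closure_mono fun _ ⟨a, b, ha, hb, hx⟩ =>
    ⟨a, b, h ha, fun i => ⟨h (hb i).1, h (hb i).2⟩, hx⟩

/-- Every class is `K`-integral. [folklore] -/
@[simp] theorem integralSymbols_univ :
    integralSymbols p n (Set.univ : Set K) = ⊤ := by
  refine eq_top_iff.2 ?_
  rw [← closure_range_symbol p]
  exact AddSubgroup.closure_mono fun _ ⟨ab, hx⟩ =>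
    ⟨ab.1, ab.2, Set.mem_univ _, fun _ => ⟨Set.mem_univ _, Set.mem_univ _⟩, hx.symm⟩

/-- Functoriality of integral symbols: `map p f` sends `T`-integral classes to `f(T)`-integral
classes. [folklore] -/
theorem map_integralSymbols_le {L : Type w} [CommRing L] (f : K →+* L) (T : Set K) :
    (integralSymbols p n T).map (map p f) ≤ integralSymbols p n (f '' T) := by
  rw [AddSubgroup.map_le_iff_le_comap, integralSymbols, AddSubgroup.closure_le]
  rintro _ ⟨a, b, ha, hb, rfl⟩
  rw [SetLike.mem_coe, AddSubgroup.mem_comap, map_symbol]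
  refine symbol_mem_integralSymbols p (Set.mem_image_of_mem f ha) fun i => ⟨?_, ?_⟩
  · simpa only [comp_apply, Units.coe_map, MonoidHom.coe_coe] using
      Set.mem_image_of_mem f (hb i).1
  · simpa only [comp_apply, ← map_inv, Units.coe_map, MonoidHom.coe_coe] using
      Set.mem_image_of_mem f (hb i).2

/-- Integrality transported along a ring map into a subset containing the image of `T`.
[folklore] -/
theorem map_mem_integralSymbols_of_mem {L : Type w} [CommRing L] (f : K →+* L) {T : Set K}
    {T' : Set L} (hT : Set.MapsTo f T T') {x : KatoCohomologySymbolic p K n}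
    (hx : x ∈ integralSymbols p n T) : map p f x ∈ integralSymbols p n T' :=
  integralSymbols_mono p hT.image_subset (map_integralSymbols_le p f T ⟨x, hx, rfl⟩)

end Integral

/-! ### The case `n = 2` (`H³_p`), in the pair notation `![b, c]` used by route WildPurity -/

section Pair

/-- `update ![x, y] 0 z = ![z, y]`. [folklore] -/
private theorem update_vec2_zero {α : Type*} (x y z : α) : update ![x, y] 0 z = ![z, y] := by
  funext i; fin_cases i <;> simp

/-- `update ![x, y] 1 z = ![x, z]`. [folklore] -/
private theorem update_vec2_one {α : Type*} (x y z : α) : update ![x, y] 1 z = ![x, z] := by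
  funext i; fin_cases i <;> simp

/-- `[a, b * b', c} = [a, b, c} + [a, b', c}`. [cite: BlochKato1986, Lemma (4.2)] -/
theorem symbol_pair_mul_left (a : K) (b b' c : Kˣ) :
    symbol p a ![b * b', c] = symbol p a ![b, c] + symbol p a ![b', c] := by
  simpa only [update_vec2_zero] using symbol_update_mul p a ![b, c] 0 b b'

/-- `[a, b, c * c'} = [a, b, c} + [a, b, c'}`. [cite: BlochKato1986, Lemma (4.2)] -/
theorem symbol_pair_mul_right (a : K) (b c c' : Kˣ) :
    symbol p a ![b, c * c'] = symbol p a ![b, c] + symbol p a ![b, c'] := by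
  simpa only [update_vec2_one] using symbol_update_mul p a ![b, c] 1 c c'

/-- `[a, b, b} = 0`. [cite: BlochKato1986, Lemma (4.2), (4.2.1)] -/
@[simp] theorem symbol_pair_self (a : K) (b : Kˣ) : symbol p a ![b, b] = 0 :=
  symbol_eq_zero_of_apply_eq p a ![b, b] (i := 0) (j := 1) (by decide) (by simp)

/-- `[b, b, c} = 0`. [cite: BlochKato1986, Lemma (4.2), (4.2.2)] -/
@[simp] theorem symbol_pair_left (b c : Kˣ) : symbol p (b : K) ![b, c] = 0 := by
  simpa using symbol_apply_self p ![b, c] 0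

/-- `[c, b, c} = 0`. [cite: BlochKato1986, Lemma (4.2), (4.2.2)] -/
@[simp] theorem symbol_pair_right (b c : Kˣ) : symbol p (c : K) ![b, c] = 0 := by
  simpa using symbol_apply_self p ![b, c] 1

/-- Antisymmetry in the two unit slots: `[a, c, b} = -[a, b, c}` (from `[a, bc, bc} = 0`).
[folklore] -/
theorem symbol_pair_swap (a : K) (b c : Kˣ) : symbol p a ![c, b] = -symbol p a ![b, c] := by
  have h := symbol_pair_self p a (b * c)
  rw [symbol_pair_mul_left, symbol_pair_mul_right, symbol_pair_mul_right, symbol_pair_self,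
    symbol_pair_self, zero_add, add_zero] at h
  rw [eq_neg_iff_add_eq_zero, add_comm]
  exact h

/-- `[a ^ p - a, b, c} = 0` in `H³_p(K)`. [cite: Izhboldin1996, Def. 1.4] -/
theorem symbol_pair_artinSchreier (a : K) (b c : Kˣ) : symbol p (a ^ p - a) ![b, c] = 0 :=
  symbol_artinSchreier p a ![b, c]

/-- `![b 0, b 1] = b`. [folklore] -/
private theorem vec2_eta {α : Type*} (b : Fin 2 → α) : ![b 0, b 1] = b := by
  funext i; fin_cases i <;> rfl

end Pair

/-! ### `H³_p(K)` presented on triples `K × Kˣ × Kˣ` (verbatim the presentation inlined by `let`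
in the items of route WildPurity, summit ResolutionOfSingularities) and its identification with
`KatoCohomologySymbolic p K 2` -/

section H3Pair

variable (K)

/-- The seven defining relations of `H³_p(K)` on the generators `(a, b, c) : K × Kˣ × Kˣ`
(symbol `[a, b, c}`): additive in `a`, multiplicative in `b` and in `c`, `[a, b, b} = 0`,
`[b, b, c} = 0`, `[c, b, c} = 0`, `[a ^ p - a, b, c} = 0` — the `n = 2` instance of
`katoRelations`, written on pairs instead of `Fin 2`-vectors (verbatim the set inlined in route
WildPurity). [cite: BlochKato1986, Lemma (4.2), p. 122]; [cite: Izhboldin1996, Def. 1.4] -/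
def pairRelations : Set (FreeAbelianGroup (K × Kˣ × Kˣ)) :=
  {x | (∃ (a a' : K) (b c : Kˣ), x = .of (a + a', b, c) - .of (a, b, c) - .of (a', b, c)) ∨
    (∃ (a : K) (b b' c : Kˣ), x = .of (a, b * b', c) - .of (a, b, c) - .of (a, b', c)) ∨
    (∃ (a : K) (b c c' : Kˣ), x = .of (a, b, c * c') - .of (a, b, c) - .of (a, b, c')) ∨
    (∃ (a : K) (b : Kˣ), x = .of (a, b, b)) ∨ (∃ (b c : Kˣ), x = .of ((b : K), b, c)) ∨
    (∃ (b c : Kˣ), x = .of ((c : K), b, c)) ∨ (∃ (a : K) (b c : Kˣ), x = .of (a ^ p - a, b, c))}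

/-- `H³_p(K)` in the pair presentation: `FreeAbelianGroup (K × Kˣ × Kˣ)` modulo the subgroup
generated by `pairRelations p K`.  Canonically isomorphic to `KatoCohomologySymbolic p K 2`
(`pairEquiv`). [cite: Kato1982, §1]; [cite: Izhboldin1996, Def. 1.4] -/
abbrev H3Pair : Type u :=
  FreeAbelianGroup (K × Kˣ × Kˣ) ⧸ AddSubgroup.closure (pairRelations p K)

variable {K}

/-- The symbol `[a, b, c} ∈ H³_p(K)` (pair presentation). [cite: Kato1982, §1] -/
def pairSymbol (a : K) (b c : Kˣ) : H3Pair p K :=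
  ((FreeAbelianGroup.of (a, b, c) : FreeAbelianGroup (K × Kˣ × Kˣ)) : H3Pair p K)

/-- The class of the generator `(a, b, c)` is the symbol `[a, b, c}` (by definition).
[folklore] -/
@[simp] theorem mk_of_pair (a : K) (b c : Kˣ) :
    ((FreeAbelianGroup.of (a, b, c) : FreeAbelianGroup (K × Kˣ × Kˣ)) : H3Pair p K) =
      pairSymbol p a b c := rfl

/-- A defining relation is zero in `H3Pair`. [folklore] -/
theorem pair_mk_eq_zero_of_mem {x : FreeAbelianGroup (K × Kˣ × Kˣ)} (hx : x ∈ pairRelations p K) :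
    (x : H3Pair p K) = 0 :=
  (QuotientAddGroup.eq_zero_iff x).2 (AddSubgroup.subset_closure hx)

/-- A relation of the shape `x - y - z` gives `x = y + z` in `H3Pair`. [folklore] -/
private theorem pair_mk_eq_add_of_mem {x y z : FreeAbelianGroup (K × Kˣ × Kˣ)}
    (h : x - y - z ∈ pairRelations p K) : (x : H3Pair p K) = y + z := by
  have h' := pair_mk_eq_zero_of_mem p h
  rwa [QuotientAddGroup.mk_sub, QuotientAddGroup.mk_sub, sub_sub, sub_eq_zero] at h'

/-- `[a + a', b, c} = [a, b, c} + [a', b, c}`. [cite: BlochKato1986, Lemma (4.2)] -/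
theorem pairSymbol_add (a a' : K) (b c : Kˣ) :
    pairSymbol p (a + a') b c = pairSymbol p a b c + pairSymbol p a' b c :=
  pair_mk_eq_add_of_mem p (Or.inl ⟨a, a', b, c, rfl⟩)

/-- `[a, b * b', c} = [a, b, c} + [a, b', c}`. [cite: BlochKato1986, Lemma (4.2)] -/
theorem pairSymbol_mul_left (a : K) (b b' c : Kˣ) :
    pairSymbol p a (b * b') c = pairSymbol p a b c + pairSymbol p a b' c :=
  pair_mk_eq_add_of_mem p (Or.inr <| Or.inl ⟨a, b, b', c, rfl⟩)

/-- `[a, b, c * c'} = [a, b, c} + [a, b, c'}`. [cite: BlochKato1986, Lemma (4.2)] -/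
theorem pairSymbol_mul_right (a : K) (b c c' : Kˣ) :
    pairSymbol p a b (c * c') = pairSymbol p a b c + pairSymbol p a b c' :=
  pair_mk_eq_add_of_mem p (Or.inr <| Or.inr <| Or.inl ⟨a, b, c, c', rfl⟩)

/-- `[a, b, b} = 0`. [cite: BlochKato1986, Lemma (4.2), (4.2.1)] -/
@[simp] theorem pairSymbol_self (a : K) (b : Kˣ) : pairSymbol p a b b = 0 :=
  pair_mk_eq_zero_of_mem p (Or.inr <| Or.inr <| Or.inr <| Or.inl ⟨a, b, rfl⟩)

/-- `[b, b, c} = 0`. [cite: BlochKato1986, Lemma (4.2), (4.2.2)] -/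
@[simp] theorem pairSymbol_left (b c : Kˣ) : pairSymbol p (b : K) b c = 0 :=
  pair_mk_eq_zero_of_mem p (Or.inr <| Or.inr <| Or.inr <| Or.inr <| Or.inl ⟨b, c, rfl⟩)

/-- `[c, b, c} = 0`. [cite: BlochKato1986, Lemma (4.2), (4.2.2)] -/
@[simp] theorem pairSymbol_right (b c : Kˣ) : pairSymbol p (c : K) b c = 0 :=
  pair_mk_eq_zero_of_mem p (Or.inr <| Or.inr <| Or.inr <| Or.inr <| Or.inr <| Or.inl ⟨b, c, rfl⟩)

/-- `[a ^ p - a, b, c} = 0`. [cite: Izhboldin1996, Def. 1.4] -/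
theorem pairSymbol_artinSchreier (a : K) (b c : Kˣ) : pairSymbol p (a ^ p - a) b c = 0 :=
  pair_mk_eq_zero_of_mem p (Or.inr <| Or.inr <| Or.inr <| Or.inr <| Or.inr <| Or.inr ⟨a, b, c, rfl⟩)

/-- Two homomorphisms out of `H3Pair p K` agreeing on symbols are equal. [folklore] -/
theorem pair_hom_ext {g h : H3Pair p K →+ A}
    (H : ∀ (a : K) (b c : Kˣ), g (pairSymbol p a b c) = h (pairSymbol p a b c)) : g = h :=
  QuotientAddGroup.addMonoidHom_ext _ (FreeAbelianGroup.lift_ext _ _ fun t => H t.1 t.2.1 t.2.2)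

/-- `[a, b, c} ↦ symbol p a ![b, c]` is well defined on `H3Pair`. [folklore] -/
def pairToSymbolic : H3Pair p K →+ KatoCohomologySymbolic p K 2 :=
  QuotientAddGroup.lift _
    (FreeAbelianGroup.lift fun t : K × Kˣ × Kˣ => symbol p t.1 ![t.2.1, t.2.2]) (by
    rw [AddSubgroup.closure_le]
    rintro x (⟨a, a', b, c, rfl⟩ | ⟨a, b, b', c, rfl⟩ | ⟨a, b, c, c', rfl⟩ | ⟨a, b, rfl⟩ |
      ⟨b, c, rfl⟩ | ⟨b, c, rfl⟩ | ⟨a, b, c, rfl⟩)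
    · simp only [SetLike.mem_coe, AddMonoidHom.mem_ker, map_sub,
        FreeAbelianGroup.lift_apply_of, symbol_add]
      abel
    · simp only [SetLike.mem_coe, AddMonoidHom.mem_ker, map_sub,
        FreeAbelianGroup.lift_apply_of, symbol_pair_mul_left]
      abel
    · simp only [SetLike.mem_coe, AddMonoidHom.mem_ker, map_sub,
        FreeAbelianGroup.lift_apply_of, symbol_pair_mul_right]
      abel
    · simp only [SetLike.mem_coe, AddMonoidHom.mem_ker, FreeAbelianGroup.lift_apply_of,
        symbol_pair_self]
    · simp only [SetLike.mem_coe, AddMonoidHom.mem_ker, FreeAbelianGroup.lift_apply_of,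
        symbol_pair_left]
    · simp only [SetLike.mem_coe, AddMonoidHom.mem_ker, FreeAbelianGroup.lift_apply_of,
        symbol_pair_right]
    · simp only [SetLike.mem_coe, AddMonoidHom.mem_ker, FreeAbelianGroup.lift_apply_of,
        symbol_pair_artinSchreier])

/-- `pairToSymbolic [a, b, c} = symbol p a ![b, c]`. [folklore] -/
@[simp] theorem pairToSymbolic_pairSymbol (a : K) (b c : Kˣ) :
    pairToSymbolic p (pairSymbol p a b c) = symbol p a ![b, c] := by
  show QuotientAddGroup.lift _ _ _ (QuotientAddGroup.mk (FreeAbelianGroup.of (a, b, c))) = _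
  rw [QuotientAddGroup.lift_mk, FreeAbelianGroup.lift_apply_of]

/-- `symbol p a b ↦ [a, b 0, b 1}` respects Kato's relations for `n = 2`. [folklore] -/
theorem isKatoCompatible_pairSymbol :
    IsKatoCompatible p (n := 2) fun (a : K) (b : Fin 2 → Kˣ) => pairSymbol p a (b 0) (b 1) where
  add_left a a' b := pairSymbol_add p a a' (b 0) (b 1)
  update_mul a b i c c' := by
    fin_cases i
    · simpa using pairSymbol_mul_left p a c c' (b 1)
    · simpa using pairSymbol_mul_right p a (b 0) c c'
  eq_zero_of_apply_eq a b i j hij hb := by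
    fin_cases i <;> fin_cases j
    · exact absurd rfl hij
    · simp only [Fin.zero_eta, Fin.mk_one] at hb
      rw [hb, pairSymbol_self]
    · simp only [Fin.zero_eta, Fin.mk_one] at hb
      rw [hb, pairSymbol_self]
    · exact absurd rfl hij
  apply_self b i := by
    fin_cases i <;> simp
  artinSchreier a b := pairSymbol_artinSchreier p a (b 0) (b 1)

/-- `symbol p a b ↦ [a, b 0, b 1}`. [folklore] -/
def pairOfSymbolic : KatoCohomologySymbolic p K 2 →+ H3Pair p K :=
  lift p _ (isKatoCompatible_pairSymbol p)

/-- `pairOfSymbolic (symbol p a b) = [a, b 0, b 1}`. [folklore] -/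
@[simp] theorem pairOfSymbolic_symbol (a : K) (b : Fin 2 → Kˣ) :
    pairOfSymbolic p (symbol p a b) = pairSymbol p a (b 0) (b 1) :=
  lift_symbol p _ _ a b

variable (K) in
/-- **The pair presentation IS `KatoCohomologySymbolic p K 2`**: the canonical isomorphism
`H3Pair p K ≃+ KatoCohomologySymbolic p K 2`, `[a, b, c} ↦ symbol p a ![b, c]`. [folklore] -/
def pairEquiv : H3Pair p K ≃+ KatoCohomologySymbolic p K 2 :=
  (pairToSymbolic p).toAddEquiv (pairOfSymbolic p)
    (pair_hom_ext p fun a b c => by simp)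
    (hom_ext p fun a b => by simp [vec2_eta])

/-- `pairEquiv [a, b, c} = symbol p a ![b, c]`. [folklore] -/
@[simp] theorem pairEquiv_pairSymbol (a : K) (b c : Kˣ) :
    pairEquiv p K (pairSymbol p a b c) = symbol p a ![b, c] :=
  pairToSymbolic_pairSymbol p a b c

/-- `pairEquiv.symm (symbol p a b) = [a, b 0, b 1}`. [folklore] -/
@[simp] theorem pairEquiv_symm_symbol (a : K) (b : Fin 2 → Kˣ) :
    (pairEquiv p K).symm (symbol p a b) = pairSymbol p a (b 0) (b 1) :=
  pairOfSymbolic_symbol p a b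

/-- `pairEquiv.symm (symbol p a ![b, c]) = [a, b, c}`. [folklore] -/
theorem pairEquiv_symm_symbol_pair (a : K) (b c : Kˣ) :
    (pairEquiv p K).symm (symbol p a ![b, c]) = pairSymbol p a b c := by
  simp

/-- Integral symbols in the pair presentation: the subgroup of `H3Pair p K` generated by the
`[a, b, c}` with `a, b, b⁻¹, c, c⁻¹ ∈ T` (verbatim the `Unr T` inlined in route WildPurity).
[cite: Izhboldin1996, §2, (2.3)] -/
def pairIntegral (T : Set K) : AddSubgroup (H3Pair p K) :=
  AddSubgroup.closure {y | ∃ (a : K) (b c : Kˣ), a ∈ T ∧ (b : K) ∈ T ∧ ((b⁻¹ : Kˣ) : K) ∈ T ∧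
    (c : K) ∈ T ∧ ((c⁻¹ : Kˣ) : K) ∈ T ∧ y = pairSymbol p a b c}

/-- A `T`-integral symbol lies in `pairIntegral p T`. [folklore] -/
theorem pairSymbol_mem_pairIntegral {T : Set K} {a : K} {b c : Kˣ} (ha : a ∈ T) (hb : (b : K) ∈ T)
    (hb' : ((b⁻¹ : Kˣ) : K) ∈ T) (hc : (c : K) ∈ T) (hc' : ((c⁻¹ : Kˣ) : K) ∈ T) :
    pairSymbol p a b c ∈ pairIntegral p T :=
  AddSubgroup.subset_closure ⟨a, b, c, ha, hb, hb', hc, hc', rfl⟩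

/-- `pairEquiv` identifies the integral symbols of the two presentations. [folklore] -/
theorem map_pairIntegral (T : Set K) :
    (pairIntegral p T).map (pairEquiv p K).toAddMonoidHom = integralSymbols p 2 T := by
  apply le_antisymm
  · rw [AddSubgroup.map_le_iff_le_comap, pairIntegral, AddSubgroup.closure_le]
    rintro _ ⟨a, b, c, ha, hb, hb', hc, hc', rfl⟩
    rw [SetLike.mem_coe, AddSubgroup.mem_comap, AddEquiv.coe_toAddMonoidHom, pairEquiv_pairSymbol]
    refine symbol_mem_integralSymbols p ha fun i => ?_
    fin_cases i
    · exact ⟨by simpa using hb, by simpa using hb'⟩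
    · exact ⟨by simpa using hc, by simpa using hc'⟩
  · rw [integralSymbols, AddSubgroup.closure_le]
    rintro _ ⟨a, b, ha, hb, rfl⟩
    refine ⟨pairSymbol p a (b 0) (b 1),
      pairSymbol_mem_pairIntegral p ha (hb 0).1 (hb 0).2 (hb 1).1 (hb 1).2, ?_⟩
    rw [AddEquiv.coe_toAddMonoidHom, pairEquiv_pairSymbol, vec2_eta]

/-- Integrality is the same in both presentations. [folklore] -/
theorem mem_pairIntegral_iff (T : Set K) (x : H3Pair p K) :
    x ∈ pairIntegral p T ↔ pairEquiv p K x ∈ integralSymbols p 2 T := by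
  rw [← map_pairIntegral, AddSubgroup.mem_map_equiv, AddEquiv.symm_apply_apply]

end H3Pair

end KatoCohomologySymbolic

end Literature.NumberTheory.GaloisCohomology
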